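import Mathlib
import HarnessLib

/-!
# `RigorousRGSmallParameter` (Slade, Theorem 1.4.1): Lemma 2.1.2 PROVED — Kato's formula
# `1/(t^β + a) = ∫₀^∞ ρ^{(β)}(s,a)/(s+t) ds` for the resolvent of a fractional power

Companion of `RigorousRGSmallParameterTorusResolvent.lean` / `…FracLaplacian.lean` in the proof
architecture of the barrier `RigorousRGSmallParameter.lean`. Source: G. Slade, *Critical
exponents for long-range `O(n)` models below the upper critical dimension*, CMP 358 (2018),
arXiv:1611.06169, §2.1.2 "Resolvent of fractional Laplacian": the density (2.15)
`ρ^{(β)}(s,a) = (sin πβ/π) · s^β/(s^{2β} + a² + 2as^β cos πβ)` and **Lemma 2.1.2**: "Let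
`β ∈ (0,1)`, `t ≥ 0` and `a ≥ 0`, excepting `t = a = 0`. Then
`1/(t^β + a) = ∫₀^∞ ρ^{(β)}(s,a)/(s+t) ds`" — "due to [Kato60] (see also [Yosi80]), and …
rediscovered in [Mitt16]. Because it plays an essential role in our analysis, we provide a simple
direct proof". It is the input of Proposition 2.1.3 (`((-Δ)^β + m²)⁻¹ = ∫₀^∞ (-Δ+s)⁻¹ ρ^{(β)}(s,m²)ds`),
through which every covariance estimate and the finite-range decomposition of §3 for the
fractional Laplacian are obtained from those of the Laplacian.

## The proof formalised here

The printed proof is a keyhole-contour integral (Cauchy's formula for `1/((z-t)(z^β+a))` on the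
cut plane), for which Mathlib has no residue calculus. We prove the lemma by a transform
argument using only real-variable measure theory and the identity theorem:

1. `Kato.integral_cpow_div_one_add`: Euler's integral `∫₀^∞ x^{ν-1}/(1+x) dx = B(ν,1-ν) =
   π/sin(πν)` (`0 < Re ν < 1`; Mathlib's Beta function after `x = y/(1+y)`, reflection formula);
   `Kato.integral_cpow_div_add`: **`∫₀^∞ x^{ν-1}/(x+w) dx = π w^{ν-1}/sin(πν)` for every `w` in
   the slit plane** (scaling for `w > 0`, then analytic continuation in `w`: the integral is
   holomorphic by differentiation under the integral sign, the slit plane is star-shaped, identity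
   theorem).
2. `Kato.integral_cpow_mul_div_quad`: `∫₀^∞ u^{ν-1}·u/(u²+2a cos θ u+a²) du =
   π a^{ν-1} sin(νθ)/(sin θ sin πν)` by partial fractions over the roots `-ae^{±iθ}`.
3. Mellin transforms (`0 < Re s < β`, `a > 0`): `Kato.mellin_inv_rpow_add`
   (`∫ t^{s-1}/(t^β+a) = π a^{s/β-1}/(β sin(πs/β))`, via `u = t^β`), `Kato.mellin_katoDensity`
   (`∫ x^{s-1}ρ^{(β)}(x,a) = a^{s/β-1} sin(πs)/(β sin(πs/β))`), and — by Fubini, justified by the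
   decay `ρ ≤ min(s^β/a², s^{-β})/(π sin πβ)` — `Kato.mellin_katoStieltjes`: the right-hand side
   `S(t) = ∫ρ/(s+t)` has **the same Mellin transform** `π a^{s/β-1}/(β sin(πs/β))`.
4. `Kato.eqOn_of_mellin_eq`: **uniqueness** — two nonnegative functions, continuous on `(0,∞)`,
   Mellin-integrable at `σ` and with equal Mellin transforms on the line `Re s = σ`, are equal
   (the finite measures `t^{σ-1}f(t)dt` pushed forward by `log` have equal characteristic
   functions; Mathlib's `Measure.ext_of_charFun`).
5. `Kato.kato_formula_pos` (`t, a > 0`, with `σ = β/2`), `Slade2017_lem212` (all printed cases: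
   `t = 0` by right-continuity of both sides — dominated convergence with majorant `ρ/s` — and
   `a = 0` directly, `ρ^{(β)}(s,0) = (sin πβ/π)s^{-β}`); also `Kato.katoDensity_pos`
   ("`ρ^{(β)}(s,a) ≥ 0`", [Mitt16]) and `Kato.continuousOn_katoStieltjes`.

Everything is proved; no named fact is introduced. Not treated here: Proposition 2.1.3 and the
display `((-Δ)^β+m²)⁻¹𝟙 = m⁻²𝟙` (Fubini over the Brillouin zone on top of this lemma).

## References

* T. Kato, *Note on fractional powers of linear operators*, Proc. Japan Acad. 36 (1960) 94–96.
* G. Slade, CMP 358 (2018), arXiv:1611.06169, §2.1.2, (2.15)–(2.16), Lemma 2.1.2. [Slade2017]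
-/

noncomputable section

namespace Literature.Barriers.CriticalPhenomena

open _root_.MeasureTheory _root_.ProbabilityTheory Set Filter Complex
open scoped _root_.Topology Real ENNReal NNReal

namespace LongRangePhi4

namespace Kato

/-! ### Complex powers of positive reals -/

/-- `x^z = e^{z log x}` for real `x > 0`. [folklore] -/
theorem cpow_ofReal_pos {x : ℝ} (hx : 0 < x) (z : ℂ) :
    (x : ℂ) ^ z = Complex.exp (z * (Real.log x : ℂ)) := by
  rw [cpow_def_of_ne_zero (ofReal_ne_zero.2 hx.ne'), ← ofReal_log hx.le, mul_comm]

/-! ### `∫₀^∞ x^{ν-1}/(1+x) dx = π / sin(πν)` -/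

/-- The change of variables `x = y/(1+y)` maps `(0,∞)` onto `(0,1)`. [folklore] -/
theorem image_div_one_add_Ioi :
    (fun y : ℝ => y / (1 + y)) '' Ioi 0 = Ioo 0 1 := by
  ext x
  constructor
  · rintro ⟨y, hy, rfl⟩
    have hy : 0 < y := hy
    exact ⟨by positivity, (div_lt_one (by positivity)).2 (by linarith)⟩
  · rintro ⟨h0, h1⟩
    refine ⟨x / (1 - x), div_pos h0 (by linarith), ?_⟩
    have : 1 - x ≠ 0 := by linarith
    field_simp
    ring

/-- **Euler's integral `∫₀^∞ x^{ν-1}/(1+x) dx = B(ν, 1-ν) = π/sin(πν)`** for `0 < Re ν < 1`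
(Beta function at `(ν, 1-ν)` after `x = y/(1+y)`, and the reflection formula). [folklore] -/
theorem integral_cpow_div_one_add {ν : ℂ} (h0 : 0 < ν.re) (h1 : ν.re < 1) :
    ∫ x in Ioi (0 : ℝ), (x : ℂ) ^ (ν - 1) / (1 + x) = π / Complex.sin (π * ν) := by
  -- Beta function
  have hB : Complex.betaIntegral ν (1 - ν) = π / Complex.sin (π * ν) := by
    have h := Complex.Gamma_mul_Gamma_eq_betaIntegral (s := ν) (t := 1 - ν) h0
      (by simp only [sub_re, one_re]; linarith)
    rw [add_sub_cancel, Complex.Gamma_one, one_mul, Complex.Gamma_mul_Gamma_one_sub] at h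
    exact h.symm
  rw [← hB, Complex.betaIntegral, intervalIntegral.integral_of_le zero_le_one,
    integral_Ioc_eq_integral_Ioo, ← image_div_one_add_Ioi]
  -- change of variables
  have hderiv : ∀ y ∈ Ioi (0 : ℝ), HasDerivWithinAt (fun y : ℝ => y / (1 + y))
      (1 / (1 + y) ^ 2) (Ioi 0) y := by
    intro y hy
    have hy : 0 < y := hy
    have h : HasDerivAt (fun y : ℝ => y / (1 + y)) ((1 * (1 + y) - y * (0 + 1)) / (1 + y) ^ 2) y :=
      (hasDerivAt_id' y).div ((hasDerivAt_const y 1).add (hasDerivAt_id' y)) (by positivity)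
    have e : (1 * (1 + y) - y * (0 + 1)) / (1 + y) ^ 2 = 1 / (1 + y) ^ 2 := by ring
    rw [e] at h
    exact h.hasDerivWithinAt
  have hinj : InjOn (fun y : ℝ => y / (1 + y)) (Ioi 0) := by
    intro y hy y' hy' h
    have hy : 0 < y := hy
    have hy' : 0 < y' := hy'
    have : y * (1 + y') = y' * (1 + y) := by
      field_simp at h
      linarith [h]
    linarith
  rw [integral_image_eq_integral_abs_deriv_smul measurableSet_Ioi hderiv hinj]
  refine setIntegral_congr_fun measurableSet_Ioi fun y hy => ?_
  have hy : 0 < y := hy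
  have h1y : (0 : ℝ) < 1 + y := by positivity
  have h1y' : ((1 + y : ℝ) : ℂ) ≠ 0 := ofReal_ne_zero.2 h1y.ne'
  rw [abs_of_pos (by positivity)]
  -- the three complex powers of positive reals as exponentials
  have e1 : ((y / (1 + y) : ℝ) : ℂ) ^ (ν - 1) =
      Complex.exp ((ν - 1) * ((Real.log y - Real.log (1 + y) : ℝ) : ℂ)) := by
    rw [cpow_ofReal_pos (by positivity), Real.log_div hy.ne' h1y.ne']
  have e2 : (1 - ((y / (1 + y) : ℝ) : ℂ)) ^ ((1 : ℂ) - ν - 1) =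
      Complex.exp (-ν * ((-Real.log (1 + y) : ℝ) : ℂ)) := by
    have h2 : (1 : ℂ) - ((y / (1 + y) : ℝ) : ℂ) = (((1 + y)⁻¹ : ℝ) : ℂ) := by
      push_cast at h1y' ⊢
      field_simp
      ring
    rw [h2, cpow_ofReal_pos (by positivity), Real.log_inv]
    congr 1
    push_cast
    ring
  have e3 : ((y : ℝ) : ℂ) ^ (ν - 1) = Complex.exp ((ν - 1) * ((Real.log y : ℝ) : ℂ)) :=
    cpow_ofReal_pos hy _
  have e4 : Complex.exp ((Real.log (1 + y) : ℝ) : ℂ) = ((1 + y : ℝ) : ℂ) := by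
    rw [ofReal_log h1y.le, Complex.exp_log h1y']
  have key : Complex.exp ((ν - 1) * ((Real.log y - Real.log (1 + y) : ℝ) : ℂ)) *
      Complex.exp (-ν * ((-Real.log (1 + y) : ℝ) : ℂ)) =
      Complex.exp ((ν - 1) * ((Real.log y : ℝ) : ℂ)) * ((1 + y : ℝ) : ℂ) := by
    rw [← e4, ← Complex.exp_add, ← Complex.exp_add]
    congr 1
    push_cast
    ring
  rw [e1, e2, e3, key, real_smul]
  push_cast at h1y' ⊢
  field_simp

/-- **`∫₀^∞ x^{ν-1}/(x+w) dx = π w^{ν-1}/sin(πν)`** for real `w > 0`, `0 < Re ν < 1` (scaling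
`x = wy`). [folklore] -/
theorem integral_cpow_div_add_ofReal {ν : ℂ} (h0 : 0 < ν.re) (h1 : ν.re < 1) {w : ℝ} (hw : 0 < w) :
    ∫ x in Ioi (0 : ℝ), (x : ℂ) ^ (ν - 1) / (x + w) = π * (w : ℂ) ^ (ν - 1) / Complex.sin (π * ν) := by
  have h := integral_comp_mul_left_Ioi (fun x : ℝ => (x : ℂ) ^ (ν - 1) / (x + w)) 0 hw
  rw [mul_zero] at h
  have hw' : (w : ℂ) ≠ 0 := ofReal_ne_zero.2 hw.ne'
  -- `∫ g(wy) dy = w^{ν-1} w⁻¹ ∫ y^{ν-1}/(1+y) dy`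
  have h2 : ∫ y in Ioi (0 : ℝ), (fun x : ℝ => (x : ℂ) ^ (ν - 1) / (x + w)) (w * y) =
      (w : ℂ) ^ (ν - 1) * (w : ℂ)⁻¹ * ∫ y in Ioi (0 : ℝ), (y : ℂ) ^ (ν - 1) / (1 + y) := by
    rw [← integral_const_mul]
    refine setIntegral_congr_fun measurableSet_Ioi fun y hy => ?_
    have hy : 0 < y := hy
    simp only
    push_cast
    rw [mul_cpow_ofReal_nonneg hw.le hy.le]
    have : (w : ℂ) * y + w = w * (1 + y) := by ring
    rw [this]
    have h1y : (1 : ℂ) + y ≠ 0 := by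
      have : (0 : ℝ) < 1 + y := by positivity
      exact_mod_cast this.ne'
    field_simp
  rw [h2, integral_cpow_div_one_add h0 h1, real_smul] at h
  have h3 : ∫ x in Ioi (0 : ℝ), (x : ℂ) ^ (ν - 1) / (x + w) =
      (w : ℂ) * ((w : ℂ) ^ (ν - 1) * (w : ℂ)⁻¹ * (π / Complex.sin (π * ν))) := by
    rw [h]
    push_cast
    field_simp
  rw [h3]
  field_simp

/-! ### Analytic continuation in `w` to the slit plane -/

/-- For `w` in the slit plane, `|x + w|` is bounded below on `x ≥ 0`:
`|x + w| ≥ ‖w‖` if `Re w ≥ 0`, `≥ |Im w|` otherwise. [folklore] -/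
def slitGap (w : ℂ) : ℝ := if 0 ≤ w.re then ‖w‖ else |w.im|

/-- `slitGap w > 0` on the slit plane. [folklore] -/
theorem slitGap_pos {w : ℂ} (hw : w ∈ slitPlane) : 0 < slitGap w := by
  unfold slitGap
  rcases hw with h | h
  · rw [if_pos h.le]
    exact norm_pos_iff.2 fun h0 => by simp [h0] at h
  · split_ifs
    · exact norm_pos_iff.2 fun h0 => by simp [h0] at h
    · exact abs_pos.2 h

/-- `‖x + w‖ ≥ slitGap w` for `x ≥ 0`. [folklore] -/
theorem slitGap_le_norm_add (w : ℂ) {x : ℝ} (hx : 0 ≤ x) : slitGap w ≤ ‖(x : ℂ) + w‖ := by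
  have hsq : ‖(x : ℂ) + w‖ ^ 2 = (x + w.re) ^ 2 + w.im ^ 2 := by
    rw [Complex.sq_norm, Complex.normSq_apply]
    simp only [add_re, ofReal_re, add_im, ofReal_im, zero_add]
    ring
  have hn : 0 ≤ ‖(x : ℂ) + w‖ := norm_nonneg _
  have hg0 : 0 ≤ slitGap w := by unfold slitGap; split_ifs <;> positivity
  rw [← pow_le_pow_iff_left₀ hg0 hn two_ne_zero, hsq]
  unfold slitGap
  split_ifs with h
  · have h2 : ‖w‖ ^ 2 = w.re ^ 2 + w.im ^ 2 := by
      rw [Complex.sq_norm, Complex.normSq_apply]; ring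
    rw [h2]
    nlinarith [mul_nonneg hx h, mul_nonneg hx hx]
  · rw [sq_abs]
    nlinarith [sq_nonneg (x + w.re), hx]


/-- An elementary lower bound: if `L ≥ m > 0` and `L ≥ x - R` (`R, x ≥ 0`) then
`L ≥ m(1+x)/(m+R+1)`. [folklore] -/
theorem lower_aux {m R x L : ℝ} (hm : 0 < m) (hR : 0 ≤ R) (hx : 0 ≤ x) (h1 : m ≤ L) (h2 : x - R ≤ L) :
    m / (m + R + 1) * (1 + x) ≤ L := by
  have hD : 0 < m + R + 1 := by linarith
  have hx0 : 0 ≤ x := hx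
  rw [div_mul_eq_mul_div, div_le_iff₀ hD]
  by_cases hxR : x ≤ m + R
  · nlinarith [hx]
  · push Not at hxR
    nlinarith [hx]

/-- **Uniform lower bound for `|x + w|` near a point of the slit plane**: with `m = slitGap w₀`,
for `‖w - w₀‖ < m/2` and `x ≥ 0`, `‖x + w‖ ≥ c (1 + x)` with
`c = (m/2)/(m/2 + ‖w₀‖ + m/2 + 1) > 0`. [folklore] -/
theorem norm_add_ge_of_mem_ball {w₀ w : ℂ} (hw₀ : w₀ ∈ slitPlane)
    (hw : w ∈ Metric.ball w₀ (slitGap w₀ / 2)) {x : ℝ} (hx : 0 ≤ x) :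
    slitGap w₀ / 2 / (slitGap w₀ / 2 + (‖w₀‖ + slitGap w₀ / 2) + 1) * (1 + x) ≤ ‖(x : ℂ) + w‖ := by
  have hm := slitGap_pos hw₀
  have hdist : ‖w - w₀‖ < slitGap w₀ / 2 := by rwa [Metric.mem_ball, dist_eq_norm] at hw
  refine lower_aux (by positivity) (by positivity) hx ?_ ?_
  · -- `‖x + w‖ ≥ ‖x + w₀‖ - ‖w - w₀‖ ≥ m - m/2`
    have h1 := slitGap_le_norm_add w₀ hx
    have h2 : ‖(x : ℂ) + w₀‖ ≤ ‖(x : ℂ) + w‖ + ‖w - w₀‖ := by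
      have : (x : ℂ) + w₀ = ((x : ℂ) + w) - (w - w₀) := by ring
      rw [this]
      exact norm_sub_le _ _
    linarith
  · -- `‖x + w‖ ≥ x - ‖w‖ ≥ x - (‖w₀‖ + m/2)`
    have h3 : (x : ℝ) ≤ ‖(x : ℂ) + w‖ + ‖w‖ := by
      have h := norm_sub_le ((x : ℂ) + w) w
      rw [add_sub_cancel_right, Complex.norm_of_nonneg hx] at h
      exact h
    have h4 : ‖w‖ ≤ ‖w₀‖ + slitGap w₀ / 2 := by
      have h := norm_add_le (w - w₀) w₀
      rw [sub_add_cancel] at h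
      linarith
    linarith

/-- `x ↦ x^a/(1+x)` is integrable on `(0,∞)` for `-1 < a < 0`. [folklore] -/
theorem integrableOn_rpow_div_one_add {a : ℝ} (ha : -1 < a) (ha' : a < 0) :
    IntegrableOn (fun x : ℝ => x ^ a / (1 + x)) (Ioi 0) := by
  have hmeas : ∀ s : Set ℝ, MeasurableSet s →
      AEStronglyMeasurable (fun x : ℝ => x ^ a / (1 + x)) (volume.restrict s) := fun s _ =>
    ((measurable_id.pow_const a).div (measurable_const.add measurable_id)).aestronglyMeasurable
  have h1 : IntegrableOn (fun x : ℝ => x ^ a / (1 + x)) (Ioc 0 1) := by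
    have hint : IntegrableOn (fun x : ℝ => x ^ a) (Ioc 0 1) :=
      (intervalIntegral.intervalIntegrable_rpow' ha (a := 0) (b := 1)).1
    refine hint.mono' (hmeas _ measurableSet_Ioc) ?_
    refine (ae_restrict_iff' measurableSet_Ioc).2 (Eventually.of_forall fun x hx => ?_)
    have hx0 : 0 < x := hx.1
    rw [Real.norm_eq_abs, abs_of_nonneg (by positivity)]
    exact div_le_self (by positivity) (by linarith)
  have h2 : IntegrableOn (fun x : ℝ => x ^ a / (1 + x)) (Ioi 1) := by
    have hint : IntegrableOn (fun x : ℝ => x ^ (a - 1)) (Ioi 1) :=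
      integrableOn_Ioi_rpow_of_lt (by linarith) one_pos
    refine hint.mono' (hmeas _ measurableSet_Ioi) ?_
    refine (ae_restrict_iff' measurableSet_Ioi).2 (Eventually.of_forall fun x hx => ?_)
    have hx1 : 1 < x := hx
    rw [Real.norm_eq_abs, abs_of_nonneg (by positivity), Real.rpow_sub_one (by positivity),
      div_le_div_iff_of_pos_left (Real.rpow_pos_of_pos (by positivity) _) (by positivity) (by positivity)]
    linarith
  have h := h1.union h2
  rwa [Ioc_union_Ioi_eq_Ioi zero_le_one] at h

/-- Norm of the integrand: `‖x^{ν-1}/(x+w)‖ = x^{Re ν-1}/‖x+w‖` for `x > 0`. [folklore] -/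
theorem norm_cpow_div_add {ν w : ℂ} {x : ℝ} (hx : 0 < x) :
    ‖(x : ℂ) ^ (ν - 1) / ((x : ℂ) + w)‖ = x ^ (ν.re - 1) / ‖(x : ℂ) + w‖ := by
  rw [norm_div, norm_cpow_eq_rpow_re_of_pos hx]
  simp

/-- `x ↦ x^{ν-1}/(x+w)` is integrable on `(0,∞)` for `0 < Re ν < 1` and `w` in the slit plane.
[folklore] -/
theorem integrableOn_cpow_div_add {ν : ℂ} (h0 : 0 < ν.re) (h1 : ν.re < 1) {w : ℂ}
    (hw : w ∈ slitPlane) :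
    IntegrableOn (fun x : ℝ => (x : ℂ) ^ (ν - 1) / (x + w)) (Ioi 0) := by
  have hm : 0 < slitGap w := slitGap_pos hw
  have ha : -1 < ν.re - 1 := by linarith
  have ha' : ν.re - 1 < 0 := by linarith
  set c := slitGap w / 2 / (slitGap w / 2 + (‖w‖ + slitGap w / 2) + 1) with hc_def
  have hc : 0 < c := by positivity
  have hlow : ∀ x : ℝ, 0 ≤ x → c * (1 + x) ≤ ‖(x : ℂ) + w‖ := fun x hx =>
    norm_add_ge_of_mem_ball hw (Metric.mem_ball_self (half_pos hm)) hx
  refine Integrable.mono' ((integrableOn_rpow_div_one_add ha ha').const_mul c⁻¹)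
    (((continuous_ofReal.measurable.pow_const _).div
      (continuous_ofReal.measurable.add_const _)).aestronglyMeasurable) ?_
  refine (ae_restrict_iff' measurableSet_Ioi).2 (Eventually.of_forall fun x hx => ?_)
  have hx : 0 < x := hx
  have hl := hlow x hx.le
  have hpos : 0 < ‖(x : ℂ) + w‖ := lt_of_lt_of_le (by positivity) hl
  rw [norm_cpow_div_add hx, div_le_iff₀ hpos]
  calc x ^ (ν.re - 1) = c⁻¹ * (x ^ (ν.re - 1) / (1 + x)) * (c * (1 + x)) := by
        field_simp
    _ ≤ c⁻¹ * (x ^ (ν.re - 1) / (1 + x)) * ‖(x : ℂ) + w‖ := by gcongr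

/-- **The Stieltjes-type integral `w ↦ ∫₀^∞ x^{ν-1}/(x+w) dx` is complex differentiable on the
slit plane** (differentiation under the integral sign, dominated by `K x^{Re ν-1}/(1+x)`).
[folklore] -/
theorem hasDerivAt_integral_cpow_div_add {ν : ℂ} (h0 : 0 < ν.re) (h1 : ν.re < 1) {w₀ : ℂ}
    (hw₀ : w₀ ∈ slitPlane) :
    HasDerivAt (fun w : ℂ => ∫ x in Ioi (0 : ℝ), (x : ℂ) ^ (ν - 1) / (x + w))
      (∫ x in Ioi (0 : ℝ), (0 * ((x : ℂ) + w₀) - (x : ℂ) ^ (ν - 1) * 1) / ((x : ℂ) + w₀) ^ 2) w₀ := by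
  have hm : 0 < slitGap w₀ := slitGap_pos hw₀
  obtain ⟨c, hc, hlow⟩ : ∃ c : ℝ, 0 < c ∧ ∀ w ∈ Metric.ball w₀ (slitGap w₀ / 2), ∀ x : ℝ, 0 ≤ x →
      c * (1 + x) ≤ ‖(x : ℂ) + w‖ :=
    ⟨slitGap w₀ / 2 / (slitGap w₀ / 2 + (‖w₀‖ + slitGap w₀ / 2) + 1), by positivity,
      fun w hw x hx => norm_add_ge_of_mem_ball hw₀ hw hx⟩
  have hne : ∀ w ∈ Metric.ball w₀ (slitGap w₀ / 2), ∀ x : ℝ, 0 ≤ x → (x : ℂ) + w ≠ 0 := by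
    intro w hw x hx h
    have := hlow w hw x hx
    rw [h, norm_zero] at this
    nlinarith
  have ha : -1 < ν.re - 1 := by linarith
  have ha' : ν.re - 1 < 0 := by linarith
  have hmeasF : ∀ w : ℂ, AEStronglyMeasurable (fun x : ℝ => (x : ℂ) ^ (ν - 1) / (x + w))
      (volume.restrict (Ioi 0)) := fun w =>
    ((continuous_ofReal.measurable.pow_const _).div
      (continuous_ofReal.measurable.add_const _)).aestronglyMeasurable
  have hF_int : Integrable (fun x : ℝ => (x : ℂ) ^ (ν - 1) / (x + w₀)) (volume.restrict (Ioi 0)) := by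
    refine Integrable.mono' ((integrableOn_rpow_div_one_add ha ha').const_mul c⁻¹) (hmeasF w₀) ?_
    refine (ae_restrict_iff' measurableSet_Ioi).2 (Eventually.of_forall fun x hx => ?_)
    have hx : 0 < x := hx
    have hl := hlow w₀ (Metric.mem_ball_self (half_pos hm)) x hx.le
    have hpos : 0 < ‖(x : ℂ) + w₀‖ := lt_of_lt_of_le (by positivity) hl
    rw [norm_cpow_div_add hx, div_le_iff₀ hpos]
    calc x ^ (ν.re - 1) = c⁻¹ * (x ^ (ν.re - 1) / (1 + x)) * (c * (1 + x)) := by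
          field_simp
      _ ≤ c⁻¹ * (x ^ (ν.re - 1) / (1 + x)) * ‖(x : ℂ) + w₀‖ := by gcongr
  have hF'_meas : AEStronglyMeasurable
      (fun x : ℝ => (0 * ((x : ℂ) + w₀) - (x : ℂ) ^ (ν - 1) * 1) / ((x : ℂ) + w₀) ^ 2)
      (volume.restrict (Ioi 0)) :=
    (((continuous_ofReal.measurable.add_const _).const_mul _).sub
      ((continuous_ofReal.measurable.pow_const _).mul_const _)).div
      ((continuous_ofReal.measurable.add_const _).pow_const _) |>.aestronglyMeasurable
  have h_bound : ∀ᵐ (x : ℝ) ∂(volume.restrict (Ioi (0 : ℝ))), ∀ w ∈ Metric.ball w₀ (slitGap w₀ / 2),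
      ‖(0 * ((x : ℂ) + w) - (x : ℂ) ^ (ν - 1) * 1) / ((x : ℂ) + w) ^ 2‖ ≤
        c⁻¹ ^ 2 * (x ^ (ν.re - 1) / (1 + x)) := by
    refine (ae_restrict_iff' measurableSet_Ioi).2 (Eventually.of_forall fun x hx => ?_)
    intro w hw
    have hx : 0 < x := hx
    have hl := hlow w hw x hx.le
    have hpos : 0 < ‖(x : ℂ) + w‖ := lt_of_lt_of_le (by positivity) hl
    rw [zero_mul, zero_sub, mul_one, norm_div, norm_neg, norm_cpow_eq_rpow_re_of_pos hx, norm_pow,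
      div_le_iff₀ (by positivity)]
    have h2 : (c * (1 + x)) ^ 2 ≤ ‖(x : ℂ) + w‖ ^ 2 := by gcongr
    have h3 : (c * (1 + x)) ^ 2 / (1 + x) ≤ ‖(x : ℂ) + w‖ ^ 2 :=
      (div_le_self (by positivity) (by linarith)).trans h2
    calc x ^ ((ν - 1).re) = x ^ (ν.re - 1) := by simp
      _ = c⁻¹ ^ 2 * (x ^ (ν.re - 1) / (1 + x)) * ((c * (1 + x)) ^ 2 / (1 + x)) := by
          field_simp
      _ ≤ c⁻¹ ^ 2 * (x ^ (ν.re - 1) / (1 + x)) * ‖(x : ℂ) + w‖ ^ 2 := by gcongr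
  have hbound_int : Integrable (fun x : ℝ => c⁻¹ ^ 2 * (x ^ (ν.re - 1) / (1 + x)))
      (volume.restrict (Ioi 0)) :=
    (integrableOn_rpow_div_one_add ha ha').const_mul _
  have h_diff : ∀ᵐ (x : ℝ) ∂(volume.restrict (Ioi (0 : ℝ))), ∀ w ∈ Metric.ball w₀ (slitGap w₀ / 2),
      HasDerivAt (fun w : ℂ => (x : ℂ) ^ (ν - 1) / (x + w))
        ((0 * ((x : ℂ) + w) - (x : ℂ) ^ (ν - 1) * 1) / ((x : ℂ) + w) ^ 2) w := by
    refine (ae_restrict_iff' measurableSet_Ioi).2 (Eventually.of_forall fun x hx => ?_)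
    intro w hw
    have hx : 0 < x := hx
    exact (hasDerivAt_const w ((x : ℂ) ^ (ν - 1))).div ((hasDerivAt_id w).const_add (x : ℂ))
      (hne w hw x hx.le)
  exact (hasDerivAt_integral_of_dominated_loc_of_deriv_le
    (F' := fun w x => (0 * ((x : ℂ) + w) - (x : ℂ) ^ (ν - 1) * 1) / ((x : ℂ) + w) ^ 2)
    (Metric.ball_mem_nhds w₀ (half_pos hm))
    (Eventually.of_forall hmeasF) hF_int hF'_meas h_bound hbound_int h_diff).2

/-- **Stieltjes transform of a power (complex form): `∫₀^∞ x^{ν-1}/(x+w) dx = π w^{ν-1}/sin(πν)`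
for `0 < Re ν < 1` and every `w ∈ ℂ ∖ (-∞,0]`** (principal branch), by analytic continuation in
`w` from the positive reals (identity theorem on the star-shaped slit plane). [folklore] -/
theorem integral_cpow_div_add {ν : ℂ} (h0 : 0 < ν.re) (h1 : ν.re < 1) {w : ℂ} (hw : w ∈ slitPlane) :
    ∫ x in Ioi (0 : ℝ), (x : ℂ) ^ (ν - 1) / (x + w) = π * w ^ (ν - 1) / Complex.sin (π * ν) := by
  set F : ℂ → ℂ := fun w => ∫ x in Ioi (0 : ℝ), (x : ℂ) ^ (ν - 1) / (x + w) with hF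
  set G : ℂ → ℂ := fun w => π * w ^ (ν - 1) / Complex.sin (π * ν) with hG
  change F w = G w
  have hFa : AnalyticOnNhd ℂ F slitPlane := by
    refine DifferentiableOn.analyticOnNhd (fun w₀ hw₀ => ?_) isOpen_slitPlane
    exact (hasDerivAt_integral_cpow_div_add h0 h1 hw₀).differentiableAt.differentiableWithinAt
  have hGa : AnalyticOnNhd ℂ G slitPlane := by
    refine DifferentiableOn.analyticOnNhd (fun w₀ hw₀ => ?_) isOpen_slitPlane
    exact (((differentiableAt_id.cpow_const (by exact hw₀)).const_mul _).div_const _).differentiableWithinAt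
  -- agreement on a real sequence tending to `1`
  have hseq : Tendsto (fun n : ℕ => (((1 + 1 / ((n : ℝ) + 1) : ℝ)) : ℂ)) atTop (𝓝[≠] (1 : ℂ)) := by
    rw [tendsto_nhdsWithin_iff]
    constructor
    · have h := ((tendsto_one_div_add_atTop_nhds_zero_nat).const_add (1 : ℝ))
      rw [add_zero] at h
      have h2 : Tendsto (fun n : ℕ => (((1 + 1 / ((n : ℝ) + 1) : ℝ)) : ℂ)) atTop (𝓝 ((1 : ℝ) : ℂ)) :=
        (continuous_ofReal.tendsto (1 : ℝ)).comp h
      rwa [ofReal_one] at h2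
    · refine Eventually.of_forall fun n => ?_
      have : (0 : ℝ) < 1 / ((n : ℝ) + 1) := by positivity
      simp only [mem_compl_iff, mem_singleton_iff]
      intro h
      rw [ofReal_eq_one] at h
      linarith
  have hfreq : ∃ᶠ z in 𝓝[≠] (1 : ℂ), F z = G z := by
    refine hseq.frequently (Frequently.of_forall fun n => ?_)
    have hpos : (0 : ℝ) < 1 + 1 / ((n : ℝ) + 1) := by positivity
    exact integral_cpow_div_add_ofReal h0 h1 hpos
  exact hFa.eqOn_of_preconnected_of_frequently_eq hGa
    (starConvex_one_slitPlane.isPathConnected Complex.one_mem_slitPlane).isConnected.isPreconnected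
    Complex.one_mem_slitPlane hfreq hw


/-! ### Kato's density `ρ^{(β)}(s,a)` -/

/-- **Kato's density** `ρ^{(β)}(s,a) = (sin πβ/π) · s^β/(s^{2β} + a² + 2a s^β cos πβ)`
(Slade (2.15); [Kato60], [Mitt16]): the spectral density in
`1/(t^β + a) = ∫₀^∞ ρ^{(β)}(s,a)/(s+t) ds`. [cite: Slade2017, §2.1.2 (display (2.15), definition of ρ^{(β)})] -/
def katoDensity (β a s : ℝ) : ℝ :=
  Real.sin (π * β) / π * (s ^ β / (s ^ (2 * β) + a ^ 2 + 2 * a * s ^ β * Real.cos (π * β)))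

/-- The denominator of `ρ^{(β)}`: `s^{2β} + a² + 2a s^β cos πβ = (s^β + a cos πβ)² + a² sin² πβ`.
[folklore] -/
theorem katoDenom_eq {β : ℝ} (a : ℝ) {s : ℝ} (hs : 0 < s) :
    s ^ (2 * β) + a ^ 2 + 2 * a * s ^ β * Real.cos (π * β) =
      (s ^ β + a * Real.cos (π * β)) ^ 2 + a ^ 2 * Real.sin (π * β) ^ 2 := by
  have h2 : s ^ (2 * β) = (s ^ β) ^ 2 := by rw [mul_comm, Real.rpow_mul hs.le, Real.rpow_two]
  rw [h2]
  nlinarith [Real.sin_sq_add_cos_sq (π * β)]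

/-- Lower bounds for the denominator: `≥ s^{2β} sin² πβ` and `≥ a² sin² πβ`. [folklore] -/
theorem katoDenom_ge {β : ℝ} (a : ℝ) {s : ℝ} (hs : 0 < s) :
    (s ^ β) ^ 2 * Real.sin (π * β) ^ 2 ≤ s ^ (2 * β) + a ^ 2 + 2 * a * s ^ β * Real.cos (π * β) ∧
    a ^ 2 * Real.sin (π * β) ^ 2 ≤ s ^ (2 * β) + a ^ 2 + 2 * a * s ^ β * Real.cos (π * β) := by
  rw [katoDenom_eq a hs]
  have hsc := Real.sin_sq_add_cos_sq (π * β)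
  constructor
  · nlinarith [sq_nonneg (s ^ β * Real.cos (π * β) + a), sq_nonneg (s ^ β), sq_nonneg a]
  · nlinarith [sq_nonneg (s ^ β + a * Real.cos (π * β))]

/-- The denominator of `ρ^{(β)}` is positive (`β ∈ (0,1)`, `s > 0`). [folklore] -/
theorem katoDenom_pos {β : ℝ} (hβ0 : 0 < β) (hβ1 : β < 1) (a : ℝ) {s : ℝ} (hs : 0 < s) :
    0 < s ^ (2 * β) + a ^ 2 + 2 * a * s ^ β * Real.cos (π * β) := by
  have hsin : 0 < Real.sin (π * β) := Real.sin_pos_of_pos_of_lt_pi (by positivity)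
    (by nlinarith [Real.pi_pos])
  have h := (katoDenom_ge a hs (β := β)).1
  have : 0 < (s ^ β) ^ 2 * Real.sin (π * β) ^ 2 := by positivity
  linarith

/-- "An elementary proof that `ρ^{(β)}(s,a) ≥ 0`" ([Mitt16]): indeed `ρ^{(β)}(s,a) > 0` for
`s > 0`, `β ∈ (0,1)`. [cite: Slade2017, §2.1.2 (after (2.15))] -/
theorem katoDensity_pos {β : ℝ} (hβ0 : 0 < β) (hβ1 : β < 1) (a : ℝ) {s : ℝ} (hs : 0 < s) :
    0 < katoDensity β a s := by
  have hsin : 0 < Real.sin (π * β) := Real.sin_pos_of_pos_of_lt_pi (by positivity)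
    (by nlinarith [Real.pi_pos])
  unfold katoDensity
  exact mul_pos (div_pos hsin Real.pi_pos) (div_pos (Real.rpow_pos_of_pos hs _) (katoDenom_pos hβ0 hβ1 a hs))

/-- **Two-sided decay of Kato's density**: `ρ^{(β)}(s,a) ≤ s^{-β}/(π sin πβ)` and, for `a ≠ 0`,
`ρ^{(β)}(s,a) ≤ s^{β}/(π a² sin πβ)`. [folklore] -/
theorem katoDensity_le {β : ℝ} (hβ0 : 0 < β) (hβ1 : β < 1) (a : ℝ) {s : ℝ} (hs : 0 < s) :
    katoDensity β a s ≤ s ^ (-β) / (π * Real.sin (π * β)) ∧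
    (a ≠ 0 → katoDensity β a s ≤ s ^ β / (π * a ^ 2 * Real.sin (π * β))) := by
  have hsin : 0 < Real.sin (π * β) := Real.sin_pos_of_pos_of_lt_pi (by positivity)
    (by nlinarith [Real.pi_pos])
  have hD := katoDenom_pos hβ0 hβ1 a hs
  obtain ⟨hD1, hD2⟩ := katoDenom_ge a hs (β := β)
  have hsb : 0 < s ^ β := Real.rpow_pos_of_pos hs _
  unfold katoDensity
  have hπ := Real.pi_pos
  constructor
  · rw [Real.rpow_neg hs.le]
    calc Real.sin (π * β) / π * (s ^ β / (s ^ (2 * β) + a ^ 2 + 2 * a * s ^ β * Real.cos (π * β)))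
        ≤ Real.sin (π * β) / π * (s ^ β / ((s ^ β) ^ 2 * Real.sin (π * β) ^ 2)) := by gcongr
      _ = (s ^ β)⁻¹ / (π * Real.sin (π * β)) := by field_simp
  · intro ha
    have ha2 : 0 < a ^ 2 := by positivity
    calc Real.sin (π * β) / π * (s ^ β / (s ^ (2 * β) + a ^ 2 + 2 * a * s ^ β * Real.cos (π * β)))
        ≤ Real.sin (π * β) / π * (s ^ β / (a ^ 2 * Real.sin (π * β) ^ 2)) := by gcongr
      _ = s ^ β / (π * a ^ 2 * Real.sin (π * β)) := by field_simp

/-- Kato's density is continuous on `(0,∞)`. [folklore] -/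
theorem continuousOn_katoDensity {β : ℝ} (hβ0 : 0 < β) (hβ1 : β < 1) (a : ℝ) :
    ContinuousOn (katoDensity β a) (Ioi 0) := by
  intro s hs
  have hs : 0 < s := hs
  unfold katoDensity
  have hc : ∀ r : ℝ, ContinuousAt (fun s : ℝ => s ^ r) s := fun r =>
    Real.continuousAt_rpow_const _ _ (Or.inl hs.ne')
  refine (continuousAt_const.mul ((hc β).div (((hc (2 * β)).add continuousAt_const).add
    ((continuousAt_const.mul (hc β)).mul continuousAt_const)) (katoDenom_pos hβ0 hβ1 a hs).ne')).continuousWithinAt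

/-- Kato's density is measurable. [folklore] -/
theorem measurable_katoDensity (β a : ℝ) : Measurable (katoDensity β a) := by
  unfold katoDensity
  fun_prop

/-! ### The roots `-a e^{±iπβ}` of the denominator and the quadratic-denominator integral -/

/-- `(u + a e^{iθ})(u + a e^{-iθ}) = u² + 2a cos θ · u + a²`. [folklore] -/
theorem quad_factor (a θ : ℝ) (u : ℂ) :
    (u + a * Complex.exp (θ * I)) * (u + a * Complex.exp (-(θ * I))) =
      u ^ 2 + 2 * a * Real.cos θ * u + (a : ℂ) ^ 2 := by
  have h1 : Complex.exp (θ * I) * Complex.exp (-(θ * I)) = 1 := by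
    rw [← Complex.exp_add, add_neg_cancel, Complex.exp_zero]
  have h2 : Complex.exp (θ * I) + Complex.exp (-(θ * I)) = 2 * Real.cos θ := by
    rw [Complex.ofReal_cos, Complex.two_cos, neg_mul]
  linear_combination (a : ℂ) * u * h2 + (a : ℂ) ^ 2 * h1

/-- `(a e^{iθ})^ν = a^ν e^{iνθ}` for `a > 0`, `θ ∈ (-π, π]` (principal branch). [folklore] -/
theorem mul_exp_cpow {a θ : ℝ} (ha : 0 < a) (hθ1 : -π < θ) (hθ2 : θ ≤ π) (ν : ℂ) :
    ((a : ℂ) * Complex.exp (θ * I)) ^ ν = (a : ℂ) ^ ν * Complex.exp (ν * θ * I) := by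
  have ha' : (a : ℂ) ≠ 0 := ofReal_ne_zero.2 ha.ne'
  have hlog : Complex.log ((a : ℂ) * Complex.exp (θ * I)) = (Real.log a : ℂ) + θ * I := by
    have : (a : ℂ) * Complex.exp (θ * I) = Complex.exp ((Real.log a : ℂ) + θ * I) := by
      rw [Complex.exp_add, ofReal_log ha.le, Complex.exp_log ha']
    rw [this, Complex.log_exp] <;> simp [hθ1, hθ2]
  rw [cpow_def_of_ne_zero (mul_ne_zero ha' (Complex.exp_ne_zero _)), hlog,
    cpow_def_of_ne_zero ha', ← ofReal_log ha.le, ← Complex.exp_add]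
  congr 1
  ring

/-- `e^{iz} - e^{-iz} = 2i sin z`. [folklore] -/
theorem exp_sub_exp_eq_sin (z : ℂ) :
    Complex.exp (z * I) - Complex.exp (-(z * I)) = 2 * I * Complex.sin z := by
  have h := Complex.two_sin z
  rw [neg_mul] at h
  linear_combination (-I) * h + (Complex.exp (z * I) - Complex.exp (-(z * I))) * I_sq

/-- `sin(πν) ≠ 0` for `0 < Re ν < 1`. [folklore] -/
theorem sin_pi_mul_ne_zero {ν : ℂ} (h0 : 0 < ν.re) (h1 : ν.re < 1) : Complex.sin (π * ν) ≠ 0 := by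
  intro hsin
  rw [Complex.sin_eq_zero_iff] at hsin
  obtain ⟨k, hk⟩ := hsin
  have h := congrArg Complex.re hk
  simp only [mul_re, intCast_re, ofReal_re, intCast_im, ofReal_im, zero_mul, sub_zero, mul_zero] at h
  have hk' : (k : ℝ) = ν.re := by
    have := Real.pi_pos
    field_simp at h
    linarith
  have h0' : (0 : ℝ) < k := by rw [hk']; exact h0
  have h1' : (k : ℝ) < 1 := by rw [hk']; exact h1
  have : (0 : ℤ) < k := by exact_mod_cast h0'
  have : k < 1 := by exact_mod_cast h1'
  omega

/-- **`∫₀^∞ u^{ν-1} · u/(u² + 2a cos θ u + a²) du = π a^{ν-1} sin(νθ)/(sin θ · sin πν)`** for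
`0 < Re ν < 1`, `a > 0`, `θ ∈ (0,π)`: partial fractions over the roots `-a e^{±iθ}` and the
Stieltjes transform of a power. [folklore] -/
theorem integral_cpow_mul_div_quad {ν : ℂ} (h0 : 0 < ν.re) (h1 : ν.re < 1) {a θ : ℝ} (ha : 0 < a)
    (hθ0 : 0 < θ) (hθπ : θ < π) :
    ∫ u in Ioi (0 : ℝ), (u : ℂ) ^ (ν - 1) * (u / ((u : ℂ) ^ 2 + 2 * a * Real.cos θ * u + (a : ℂ) ^ 2)) =
      π * (a : ℂ) ^ (ν - 1) * Complex.sin (ν * θ) / (Real.sin θ * Complex.sin (π * ν)) := by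
  set p : ℂ := a * Complex.exp (θ * I) with hp
  set q : ℂ := a * Complex.exp (-(θ * I)) with hq
  clear_value p q
  have ha0 : (a : ℂ) ≠ 0 := ofReal_ne_zero.2 ha.ne'
  have hsinθ : 0 < Real.sin θ := Real.sin_pos_of_pos_of_lt_pi hθ0 hθπ
  have hsinθ' : (Real.sin θ : ℂ) ≠ 0 := ofReal_ne_zero.2 hsinθ.ne'
  have hpq : p - q = 2 * I * a * Real.sin θ := by
    rw [hp, hq, ← mul_sub, exp_sub_exp_eq_sin, Complex.ofReal_sin]; ring
  have hpq0 : p - q ≠ 0 := by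
    rw [hpq]
    exact mul_ne_zero (mul_ne_zero (mul_ne_zero two_ne_zero I_ne_zero) ha0) hsinθ'
  have hp_slit : p ∈ slitPlane := Or.inr (by
    rw [hp]; simp [Complex.exp_re, Complex.exp_im, hsinθ.ne', ha.ne'])
  have hq_slit : q ∈ slitPlane := Or.inr (by
    rw [hq]; simp [Complex.exp_re, Complex.exp_im, hsinθ.ne', ha.ne'])
  have hp0 : p ≠ 0 := fun h => by simp [h, slitPlane] at hp_slit
  have hq0' : q ≠ 0 := fun h => by simp [h, slitPlane] at hq_slit
  -- partial fractions, pointwise on `u > 0`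
  have hpf : ∀ u : ℝ, 0 < u →
      (u : ℂ) ^ (ν - 1) * (u / ((u : ℂ) ^ 2 + 2 * a * Real.cos θ * u + (a : ℂ) ^ 2)) =
        (p - q)⁻¹ * (p * ((u : ℂ) ^ (ν - 1) / (u + p)) - q * ((u : ℂ) ^ (ν - 1) / (u + q))) := by
    intro u hu
    have hup : (u : ℂ) + p ≠ 0 := by
      intro h
      have := slitGap_le_norm_add p hu.le
      rw [h, norm_zero] at this
      linarith [slitGap_pos hp_slit]
    have huq : (u : ℂ) + q ≠ 0 := by
      intro h
      have := slitGap_le_norm_add q hu.le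
      rw [h, norm_zero] at this
      linarith [slitGap_pos hq_slit]
    rw [← quad_factor a θ u, ← hp, ← hq]
    field_simp
    ring
  rw [setIntegral_congr_fun measurableSet_Ioi (fun u hu => hpf u hu), integral_const_mul,
    integral_sub ((integrableOn_cpow_div_add h0 h1 hp_slit).const_mul p)
      ((integrableOn_cpow_div_add h0 h1 hq_slit).const_mul q),
    integral_const_mul, integral_const_mul, integral_cpow_div_add h0 h1 hp_slit,
    integral_cpow_div_add h0 h1 hq_slit]
  -- evaluate the powers of the roots
  have hpν : p * (π * p ^ (ν - 1) / Complex.sin (π * ν)) = π * p ^ ν / Complex.sin (π * ν) := by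
    rw [Complex.cpow_sub _ _ hp0, Complex.cpow_one]; field_simp
  have hqν : q * (π * q ^ (ν - 1) / Complex.sin (π * ν)) = π * q ^ ν / Complex.sin (π * ν) := by
    rw [Complex.cpow_sub _ _ hq0', Complex.cpow_one]; field_simp
  have hpow_p : p ^ ν = (a : ℂ) ^ ν * Complex.exp (ν * θ * I) := by
    rw [hp]; exact mul_exp_cpow ha (by linarith) hθπ.le ν
  have hpow_q : q ^ ν = (a : ℂ) ^ ν * Complex.exp (-(ν * θ * I)) := by
    have h := mul_exp_cpow ha (θ := -θ) (by linarith) (by linarith) ν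
    rw [hq]
    convert h using 2
    · push_cast; ring_nf
    · push_cast; ring_nf
  have hdiff : p ^ ν - q ^ ν = (a : ℂ) ^ ν * (2 * I * Complex.sin (ν * θ)) := by
    rw [hpow_p, hpow_q, ← mul_sub, ← exp_sub_exp_eq_sin]
  have haν : (a : ℂ) ^ ν = (a : ℂ) ^ (ν - 1) * a := by
    rw [Complex.cpow_sub _ _ ha0, Complex.cpow_one]
    field_simp
  have hnum : π * p ^ ν / Complex.sin (π * ν) - π * q ^ ν / Complex.sin (π * ν) =
      π * (p ^ ν - q ^ ν) / Complex.sin (π * ν) := by ring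
  rw [hpν, hqν, hnum, hdiff, hpq, haν]
  have hsin := sin_pi_mul_ne_zero h0 h1
  field_simp


/-! ### Real form of the Stieltjes transform of a power -/

/-- **`∫₀^∞ t^{σ-1}/(t+w) dt = π w^{σ-1}/sin(πσ)`** for real `0 < σ < 1`, `w > 0`. [folklore] -/
theorem integral_rpow_div_add {σ : ℝ} (h0 : 0 < σ) (h1 : σ < 1) {w : ℝ} (hw : 0 < w) :
    ∫ t in Ioi (0 : ℝ), t ^ (σ - 1) / (t + w) = π * w ^ (σ - 1) / Real.sin (π * σ) := by
  have h := integral_cpow_div_add_ofReal (ν := (σ : ℂ)) (by simpa using h0) (by simpa using h1) hw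
  have hl : ∫ t in Ioi (0 : ℝ), (t : ℂ) ^ ((σ : ℂ) - 1) / (t + w) =
      ((∫ t in Ioi (0 : ℝ), t ^ (σ - 1) / (t + w) : ℝ) : ℂ) := by
    rw [← integral_complex_ofReal]
    refine setIntegral_congr_fun measurableSet_Ioi fun t ht => ?_
    have ht : 0 < t := ht
    push_cast
    rw [Complex.ofReal_cpow ht.le]
    push_cast
    rfl
  have hr : (π : ℂ) * (w : ℂ) ^ ((σ : ℂ) - 1) / Complex.sin (π * σ) =
      ((π * w ^ (σ - 1) / Real.sin (π * σ) : ℝ) : ℂ) := by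
    push_cast
    rw [Complex.ofReal_cpow hw.le]
    push_cast
    rfl
  rw [hl, hr] at h
  exact_mod_cast h

/-! ### Powers of powers of positive reals -/

/-- `(u^r)^z = u^{rz}` for `u > 0`, real `r`, complex `z`. [folklore] -/
theorem ofReal_rpow_cpow {u : ℝ} (hu : 0 < u) (r : ℝ) (z : ℂ) :
    ((u ^ r : ℝ) : ℂ) ^ z = (u : ℂ) ^ ((r : ℂ) * z) := by
  rw [cpow_ofReal_pos (Real.rpow_pos_of_pos hu r), cpow_ofReal_pos hu, Real.log_rpow hu]
  push_cast
  ring_nf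

/-- `u^r · u^z = u^{r+z}` for `u > 0` (real power times complex power). [folklore] -/
theorem ofReal_rpow_mul_cpow {u : ℝ} (hu : 0 < u) (r : ℝ) (z : ℂ) :
    ((u ^ r : ℝ) : ℂ) * (u : ℂ) ^ z = (u : ℂ) ^ ((r : ℂ) + z) := by
  rw [Complex.ofReal_cpow hu.le, ← Complex.cpow_add _ _ (ofReal_ne_zero.2 hu.ne')]

/-! ### The Mellin transform of `t ↦ 1/(t^β + a)` -/

/-- **`∫₀^∞ t^{s-1}/(t^β + a) dt = π a^{s/β-1}/(β sin(πs/β))`** for `β > 0`, `a > 0`,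
`0 < Re s < β` (substitute `u = t^β`, then the Stieltjes transform of a power). [folklore] -/
theorem mellin_inv_rpow_add {β : ℝ} (hβ0 : 0 < β) {a : ℝ} (ha : 0 < a) {s : ℂ} (hs0 : 0 < s.re)
    (hsβ : s.re < β) :
    ∫ t in Ioi (0 : ℝ), (t : ℂ) ^ (s - 1) / ((t ^ β : ℝ) + a) =
      π * (a : ℂ) ^ (s / β - 1) / (β * Complex.sin (π * (s / β))) := by
  have hβ' : (β : ℂ) ≠ 0 := ofReal_ne_zero.2 hβ0.ne'
  have hν0 : 0 < (s / β).re := by rw [div_ofReal_re]; positivity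
  have hν1 : (s / β).re < 1 := by rw [div_ofReal_re, div_lt_one hβ0]; exact hsβ
  -- substitution `t = u^{1/β}`
  have hsub := integral_comp_rpow_Ioi_of_pos (g := fun t : ℝ => (t : ℂ) ^ (s - 1) / ((t ^ β : ℝ) + a))
    (one_div_pos.2 hβ0)
  rw [← hsub]
  have hpt : ∀ u : ℝ, 0 < u →
      ((1 / β * u ^ (1 / β - 1) : ℝ)) • ((((u ^ (1 / β) : ℝ)) : ℂ) ^ (s - 1) /
        ((((u ^ (1 / β)) ^ β : ℝ) : ℂ) + a)) =
      (1 / β : ℂ) * ((u : ℂ) ^ (s / β - 1) / (u + a)) := by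
    intro u hu
    have hu1 : (u ^ (1 / β)) ^ β = u := by rw [one_div, Real.rpow_inv_rpow hu.le hβ0.ne']
    have key : ((u ^ (1 / β - 1) : ℝ) : ℂ) * (((u ^ (1 / β) : ℝ) : ℂ) ^ (s - 1)) =
        (u : ℂ) ^ (s / β - 1) := by
      rw [ofReal_rpow_cpow hu, ofReal_rpow_mul_cpow hu]
      congr 1
      push_cast
      field_simp
      ring
    rw [hu1, real_smul, ← key]
    push_cast
    ring
  rw [setIntegral_congr_fun measurableSet_Ioi (fun u hu => hpt u hu), integral_const_mul,
    integral_cpow_div_add_ofReal hν0 hν1 ha]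
  field_simp

/-! ### The Mellin transform of Kato's density -/

/-- **`∫₀^∞ x^{s-1} ρ^{(β)}(x,a) dx = a^{s/β-1} sin(πs)/(β sin(πs/β))`** for `β ∈ (0,1)`, `a > 0`,
`0 < Re s < β` (substitute `u = x^β`, then the quadratic-denominator integral with
`θ = πβ`, `ν = s/β`). [folklore] -/
theorem mellin_katoDensity {β : ℝ} (hβ0 : 0 < β) (hβ1 : β < 1) {a : ℝ} (ha : 0 < a) {s : ℂ}
    (hs0 : 0 < s.re) (hsβ : s.re < β) :
    ∫ x in Ioi (0 : ℝ), (x : ℂ) ^ (s - 1) * (katoDensity β a x : ℂ) =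
      (a : ℂ) ^ (s / β - 1) * Complex.sin (π * s) / (β * Complex.sin (π * (s / β))) := by
  have hβ' : (β : ℂ) ≠ 0 := ofReal_ne_zero.2 hβ0.ne'
  have hν0 : 0 < (s / β).re := by rw [div_ofReal_re]; positivity
  have hν1 : (s / β).re < 1 := by rw [div_ofReal_re, div_lt_one hβ0]; exact hsβ
  have hθ0 : 0 < π * β := by positivity
  have hθπ : π * β < π := by nlinarith [Real.pi_pos]
  have hsub := integral_comp_rpow_Ioi_of_pos
    (g := fun x : ℝ => (x : ℂ) ^ (s - 1) * (katoDensity β a x : ℂ)) (one_div_pos.2 hβ0)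
  rw [← hsub]
  have hpt : ∀ u : ℝ, 0 < u →
      ((1 / β * u ^ (1 / β - 1) : ℝ)) • ((((u ^ (1 / β) : ℝ)) : ℂ) ^ (s - 1) *
        (katoDensity β a (u ^ (1 / β)) : ℂ)) =
      ((1 / β * (Real.sin (π * β) / π) : ℝ) : ℂ) *
        ((u : ℂ) ^ (s / β - 1) * (u / ((u : ℂ) ^ 2 + 2 * a * Real.cos (π * β) * u + (a : ℂ) ^ 2))) := by
    intro u hu
    have hu1 : (u ^ (1 / β)) ^ β = u := by rw [one_div β, Real.rpow_inv_rpow hu.le hβ0.ne']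
    have hu2 : (u ^ (1 / β)) ^ (2 * β) = u ^ 2 := by
      rw [mul_comm, Real.rpow_mul (Real.rpow_nonneg hu.le _), hu1, Real.rpow_two]
    have key : ((u ^ (1 / β - 1) : ℝ) : ℂ) * (((u ^ (1 / β) : ℝ) : ℂ) ^ (s - 1)) =
        (u : ℂ) ^ (s / β - 1) := by
      rw [ofReal_rpow_cpow hu, ofReal_rpow_mul_cpow hu]
      congr 1
      push_cast
      field_simp
      ring
    unfold katoDensity
    rw [hu1, hu2, real_smul, ← key]
    push_cast
    ring
  rw [setIntegral_congr_fun measurableSet_Ioi (fun u hu => hpt u hu), integral_const_mul,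
    integral_cpow_mul_div_quad hν0 hν1 ha hθ0 hθπ]
  have hsinβ : (Real.sin (π * β) : ℂ) ≠ 0 :=
    ofReal_ne_zero.2 (Real.sin_pos_of_pos_of_lt_pi hθ0 hθπ).ne'
  have hsin := sin_pi_mul_ne_zero hν0 hν1
  have hπ : (π : ℂ) ≠ 0 := ofReal_ne_zero.2 Real.pi_pos.ne'
  have harg : s / β * (π * β : ℝ) = π * s := by push_cast; field_simp
  rw [harg]
  simp only [Complex.ofReal_mul, Complex.ofReal_div, Complex.ofReal_one]
  field_simp


/-- `t ↦ t^{σ-1}/(t+w)` is integrable on `(0,∞)` for real `0 < σ < 1`, `w > 0`. [folklore] -/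
theorem integrableOn_rpow_div_add {σ : ℝ} (h0 : 0 < σ) (h1 : σ < 1) {w : ℝ} (hw : 0 < w) :
    IntegrableOn (fun t : ℝ => t ^ (σ - 1) / (t + w)) (Ioi 0) := by
  have h := (integrableOn_cpow_div_add (ν := (σ : ℂ)) (by simpa using h0) (by simpa using h1)
    (ofReal_mem_slitPlane.2 hw)).norm
  refine h.congr ((ae_restrict_iff' measurableSet_Ioi).2 (Eventually.of_forall fun t ht => ?_))
  have ht : 0 < t := ht
  show ‖(t : ℂ) ^ ((σ : ℂ) - 1) / (t + w)‖ = t ^ (σ - 1) / (t + w)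
  rw [norm_cpow_div_add ht]
  have : ((t : ℂ) + w) = ((t + w : ℝ) : ℂ) := by push_cast; rfl
  rw [this, Complex.norm_of_nonneg (by positivity)]
  simp

/-- **Mellin integrability of Kato's density**: `x ↦ x^{σ-1} ρ^{(β)}(x,a)` is integrable on
`(0,∞)` for `a ≠ 0`, `β ∈ (0,1)`, `-β < σ < β`. [folklore] -/
theorem integrableOn_rpow_mul_katoDensity {β : ℝ} (hβ0 : 0 < β) (hβ1 : β < 1) {a : ℝ}
    (ha : a ≠ 0) {σ : ℝ} (hσ0 : -β < σ) (hσβ : σ < β) :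
    IntegrableOn (fun x : ℝ => x ^ (σ - 1) * katoDensity β a x) (Ioi 0) := by
  have hsin : 0 < Real.sin (π * β) := Real.sin_pos_of_pos_of_lt_pi (by positivity)
    (by nlinarith [Real.pi_pos])
  have hmeas : ∀ S : Set ℝ, MeasurableSet S →
      AEStronglyMeasurable (fun x : ℝ => x ^ (σ - 1) * katoDensity β a x) (volume.restrict S) :=
    fun S _ => ((measurable_id.pow_const _).mul (measurable_katoDensity β a)).aestronglyMeasurable
  have h1 : IntegrableOn (fun x : ℝ => x ^ (σ - 1) * katoDensity β a x) (Ioc 0 1) := by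
    have hint : IntegrableOn (fun x : ℝ => (π * a ^ 2 * Real.sin (π * β))⁻¹ * x ^ (σ - 1 + β))
        (Ioc 0 1) :=
      ((intervalIntegral.intervalIntegrable_rpow' (by linarith) (a := 0) (b := 1)).1).const_mul _
    refine hint.mono' (hmeas _ measurableSet_Ioc) ?_
    refine (ae_restrict_iff' measurableSet_Ioc).2 (Eventually.of_forall fun x hx => ?_)
    have hx0 : 0 < x := hx.1
    have hρ := ((katoDensity_le hβ0 hβ1 a hx0).2 ha)
    rw [Real.norm_eq_abs, abs_of_nonneg (mul_nonneg (Real.rpow_nonneg hx0.le _)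
      (katoDensity_pos hβ0 hβ1 a hx0).le), Real.rpow_add hx0]
    calc x ^ (σ - 1) * katoDensity β a x ≤ x ^ (σ - 1) * (x ^ β / (π * a ^ 2 * Real.sin (π * β))) := by
          gcongr
      _ = (π * a ^ 2 * Real.sin (π * β))⁻¹ * (x ^ (σ - 1) * x ^ β) := by ring
  have h2 : IntegrableOn (fun x : ℝ => x ^ (σ - 1) * katoDensity β a x) (Ioi 1) := by
    have hint : IntegrableOn (fun x : ℝ => (π * Real.sin (π * β))⁻¹ * x ^ (σ - 1 + -β)) (Ioi 1) :=
      (integrableOn_Ioi_rpow_of_lt (by linarith) one_pos).const_mul _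
    refine hint.mono' (hmeas _ measurableSet_Ioi) ?_
    refine (ae_restrict_iff' measurableSet_Ioi).2 (Eventually.of_forall fun x hx => ?_)
    have hx1 : 1 < x := hx
    have hx0 : 0 < x := by linarith
    have hρ := (katoDensity_le hβ0 hβ1 a hx0).1
    rw [Real.norm_eq_abs, abs_of_nonneg (mul_nonneg (Real.rpow_nonneg hx0.le _)
      (katoDensity_pos hβ0 hβ1 a hx0).le), Real.rpow_add hx0]
    calc x ^ (σ - 1) * katoDensity β a x ≤ x ^ (σ - 1) * (x ^ (-β) / (π * Real.sin (π * β))) := by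
          gcongr
      _ = (π * Real.sin (π * β))⁻¹ * (x ^ (σ - 1) * x ^ (-β)) := by ring
  have h := h1.union h2
  rwa [Ioc_union_Ioi_eq_Ioi zero_le_one] at h

/-- **Fubini bound**: `(t,x) ↦ t^{σ-1} ρ^{(β)}(x,a)/(x+t)` is integrable on `(0,∞)²` for `a ≠ 0`,
`β ∈ (0,1)`, `0 < σ < β`; its iterated integral is `(π/sin πσ) ∫ x^{σ-1}ρ`. [folklore] -/
theorem integrable_prod_katoDensity {β : ℝ} (hβ0 : 0 < β) (hβ1 : β < 1) {a : ℝ} (ha : a ≠ 0)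
    {σ : ℝ} (hσ0 : 0 < σ) (hσβ : σ < β) :
    Integrable (fun p : ℝ × ℝ => p.1 ^ (σ - 1) * (katoDensity β a p.2 / (p.2 + p.1)))
      ((volume.restrict (Ioi (0 : ℝ))).prod (volume.restrict (Ioi (0 : ℝ)))) := by
  have hσ1 : σ < 1 := by linarith
  have hmeas : Measurable (fun p : ℝ × ℝ => p.1 ^ (σ - 1) * (katoDensity β a p.2 / (p.2 + p.1))) :=
    (measurable_fst.pow_const _).mul (((measurable_katoDensity β a).comp measurable_snd).div
      (measurable_snd.add measurable_fst))
  refine (integrable_prod_iff' hmeas.aestronglyMeasurable).2 ⟨?_, ?_⟩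
  · refine (ae_restrict_iff' measurableSet_Ioi).2 (Eventually.of_forall fun x hx => ?_)
    have hx : 0 < x := hx
    have h := (integrableOn_rpow_div_add hσ0 hσ1 hx).const_mul (katoDensity β a x)
    refine h.congr (Eventually.of_forall fun t => ?_)
    simp only
    ring
  · have hI := (integrableOn_rpow_mul_katoDensity hβ0 hβ1 ha (by linarith) hσβ).const_mul
      (π / Real.sin (π * σ))
    refine hI.congr ((ae_restrict_iff' measurableSet_Ioi).2 (Eventually.of_forall fun x hx => ?_))
    have hx : 0 < x := hx
    have hρ := (katoDensity_pos hβ0 hβ1 a hx).le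
    simp only
    have hnorm : ∀ t ∈ Ioi (0 : ℝ), ‖t ^ (σ - 1) * (katoDensity β a x / (x + t))‖ =
        katoDensity β a x * (t ^ (σ - 1) / (t + x)) := by
      intro t ht
      have ht : 0 < t := ht
      rw [Real.norm_eq_abs, abs_of_nonneg (by positivity)]
      rw [add_comm x t]
      ring
    rw [setIntegral_congr_fun measurableSet_Ioi hnorm, integral_const_mul,
      integral_rpow_div_add hσ0 hσ1 hx]
    ring

/-! ### The Stieltjes transform of Kato's density and its Mellin transform -/

/-- **The right-hand side of Kato's formula**: `S^{(β)}(t,a) = ∫₀^∞ ρ^{(β)}(s,a)/(s+t) ds`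
(Slade, Lemma 2.1.2, right-hand side of (2.16)). [cite: Slade2017, Lemma 2.1.2] -/
def katoStieltjes (β a t : ℝ) : ℝ := ∫ s in Ioi 0, katoDensity β a s / (s + t)

/-- **Mellin transform of the Stieltjes transform of Kato's density** (Fubini, then the
Stieltjes transform of a power, then the Mellin transform of `ρ^{(β)}`): for `β ∈ (0,1)`,
`a > 0`, `0 < Re s < β`,
`∫₀^∞ t^{s-1} S^{(β)}(t,a) dt = (π/sin πs)·∫₀^∞ x^{s-1}ρ^{(β)}(x,a) dx = π a^{s/β-1}/(β sin(πs/β))`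
— the same as the Mellin transform of `1/(t^β + a)`. [folklore] -/
theorem mellin_katoStieltjes {β : ℝ} (hβ0 : 0 < β) (hβ1 : β < 1) {a : ℝ} (ha : 0 < a) {s : ℂ}
    (hs0 : 0 < s.re) (hsβ : s.re < β) :
    ∫ t in Ioi (0 : ℝ), (t : ℂ) ^ (s - 1) * (katoStieltjes β a t : ℂ) =
      π * (a : ℂ) ^ (s / β - 1) / (β * Complex.sin (π * (s / β))) := by
  have hs1 : s.re < 1 := by linarith
  -- the integrand on the product
  set H : ℝ → ℝ → ℂ := fun t x => (t : ℂ) ^ (s - 1) * ((katoDensity β a x / (x + t) : ℝ) : ℂ) with hH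
  have hint : Integrable (Function.uncurry H)
      ((volume.restrict (Ioi (0 : ℝ))).prod (volume.restrict (Ioi (0 : ℝ)))) := by
    have hreal := integrable_prod_katoDensity hβ0 hβ1 ha.ne' hs0 hsβ
    have hmeasH : Measurable (Function.uncurry H) :=
      ((continuous_ofReal.measurable.comp measurable_fst).pow_const _).mul
        (continuous_ofReal.measurable.comp (((measurable_katoDensity β a).comp measurable_snd).div
          (measurable_snd.add measurable_fst)))
    refine hreal.mono' hmeasH.aestronglyMeasurable ?_
    rw [Measure.prod_restrict]
    refine (ae_restrict_iff' (measurableSet_Ioi.prod measurableSet_Ioi)).2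
      (Eventually.of_forall fun p hp => ?_)
    obtain ⟨t, x⟩ := p
    have hp1 : 0 < t := hp.1
    have hp2 : 0 < x := hp.2
    simp only [Function.uncurry_apply_pair, hH]
    rw [norm_mul, norm_cpow_eq_rpow_re_of_pos hp1, Complex.norm_of_nonneg (div_nonneg
      (katoDensity_pos hβ0 hβ1 a hp2).le (by positivity))]
    simp
  -- Step 1: write the Mellin integrand as an inner integral
  have hstep1 : ∀ t : ℝ, (t : ℂ) ^ (s - 1) * (katoStieltjes β a t : ℂ) = ∫ x in Ioi (0 : ℝ), H t x := by
    intro t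
    rw [katoStieltjes, ← integral_complex_ofReal, ← integral_const_mul]
  simp_rw [hstep1]
  -- Step 2: Fubini
  rw [integral_integral_swap hint]
  -- Step 3: the inner `t`-integral
  have hstep3 : ∀ x ∈ Ioi (0 : ℝ), ∫ t in Ioi (0 : ℝ), H t x =
      (katoDensity β a x : ℂ) * (π * (x : ℂ) ^ (s - 1) / Complex.sin (π * s)) := by
    intro x hx
    have hx : 0 < x := hx
    rw [← integral_cpow_div_add_ofReal hs0 hs1 hx, ← integral_const_mul]
    refine setIntegral_congr_fun measurableSet_Ioi fun t ht => ?_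
    simp only [hH]
    have ht : 0 < t := ht
    push_cast
    rw [add_comm (x : ℂ) (t : ℂ)]
    ring
  rw [setIntegral_congr_fun measurableSet_Ioi hstep3]
  -- Step 4: the Mellin transform of `ρ`
  have hstep4 : ∀ x : ℝ, (katoDensity β a x : ℂ) * (π * (x : ℂ) ^ (s - 1) / Complex.sin (π * s)) =
      π / Complex.sin (π * s) * ((x : ℂ) ^ (s - 1) * (katoDensity β a x : ℂ)) := fun x => by ring
  simp_rw [hstep4]
  rw [integral_const_mul, mellin_katoDensity hβ0 hβ1 ha hs0 hsβ]
  have hsin : Complex.sin (π * s) ≠ 0 := sin_pi_mul_ne_zero hs0 hs1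
  field_simp


/-! ### Uniqueness: equal Mellin transforms on a vertical line -/

/-- The Mellin kernel on a vertical line: `t^{σ+iy-1} = t^{σ-1} e^{iy log t}` (`t > 0`). [folklore] -/
theorem cpow_line_eq {t : ℝ} (ht : 0 < t) (σ y : ℝ) :
    (t : ℂ) ^ ((σ : ℂ) + y * I - 1) = ((t ^ (σ - 1) : ℝ) : ℂ) * Complex.exp (y * Real.log t * I) := by
  rw [cpow_ofReal_pos ht, Real.rpow_def_of_pos ht, Complex.ofReal_exp, ← Complex.exp_add]
  congr 1
  push_cast
  ring

/-- The finite measure `t^{σ-1} f(t) dt` on `(0,∞)` attached to a nonnegative `f`. [folklore] -/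
def mellinMeasure (f : ℝ → ℝ) (σ : ℝ) : Measure ℝ :=
  (volume.restrict (Ioi (0 : ℝ))).withDensity fun t => ENNReal.ofReal (t ^ (σ - 1) * f t)

/-- `t^{σ-1} f(t) dt` is a finite measure when `f` is Mellin-integrable at `σ`. [folklore] -/
theorem isFiniteMeasure_mellinMeasure {f : ℝ → ℝ} {σ : ℝ}
    (hfi : IntegrableOn (fun t => t ^ (σ - 1) * f t) (Ioi 0)) :
    IsFiniteMeasure (mellinMeasure f σ) :=
  isFiniteMeasure_withDensity_ofReal hfi.2

/-- The characteristic function of the `log`-image of `t^{σ-1} f(t) dt` is the Mellin transform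
of `f` on the line `Re = σ`. [folklore] -/
theorem charFun_map_log_mellinMeasure {f : ℝ → ℝ} {σ : ℝ} (hfc : ContinuousOn f (Ioi 0))
    (hf0 : ∀ t ∈ Ioi (0 : ℝ), 0 ≤ f t) (y : ℝ) :
    charFun ((mellinMeasure f σ).map Real.log) y =
      ∫ t in Ioi (0 : ℝ), (t : ℂ) ^ ((σ : ℂ) + y * I - 1) * (f t : ℂ) := by
  have hpc : ContinuousOn (fun t : ℝ => t ^ (σ - 1) * f t) (Ioi 0) :=
    (ContinuousOn.rpow_const continuousOn_id fun t ht => Or.inl (ne_of_gt ht)).mul hfc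
  have hpm : AEMeasurable (fun t : ℝ => (t ^ (σ - 1) * f t).toNNReal) (volume.restrict (Ioi 0)) :=
    (hpc.aemeasurable measurableSet_Ioi).real_toNNReal
  rw [charFun_apply_real, integral_map Real.measurable_log.aemeasurable (by fun_prop),
    mellinMeasure]
  change ∫ t, Complex.exp (y * Real.log t * I)
      ∂((volume.restrict (Ioi (0 : ℝ))).withDensity fun t => ((t ^ (σ - 1) * f t).toNNReal : ℝ≥0∞)) = _
  rw [integral_withDensity_eq_integral_smul₀ hpm]
  refine setIntegral_congr_fun measurableSet_Ioi fun t ht => ?_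
  have ht : 0 < t := ht
  rw [cpow_line_eq ht, NNReal.smul_def, Real.coe_toNNReal _ (mul_nonneg (Real.rpow_nonneg ht.le _)
    (hf0 t ht)), real_smul]
  push_cast
  ring

/-- `t^{σ-1} f(t) dt` is recovered from its `log`-image. [folklore] -/
theorem map_exp_map_log_mellinMeasure (f : ℝ → ℝ) (σ : ℝ) :
    ((mellinMeasure f σ).map Real.log).map Real.exp = mellinMeasure f σ := by
  rw [Measure.map_map Real.measurable_exp Real.measurable_log]
  have hae : (Real.exp ∘ Real.log) =ᵐ[mellinMeasure f σ] id := by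
    have h1 : ∀ᵐ t ∂(volume.restrict (Ioi (0 : ℝ))), (Real.exp ∘ Real.log) t = id t := by
      filter_upwards [ae_restrict_mem measurableSet_Ioi] with t ht
      exact Real.exp_log ht
    exact (withDensity_absolutelyContinuous _ _).ae_eq h1
  rw [Measure.map_congr hae, Measure.map_id]

/-- **Uniqueness of Mellin transforms on a vertical line.** Two nonnegative functions,
continuous on `(0,∞)` and Mellin-integrable at `σ`, whose Mellin transforms agree on the line
`Re = σ`, agree on `(0,∞)` (via uniqueness of characteristic functions of finite measures).
[folklore] -/
theorem eqOn_of_mellin_eq {f g : ℝ → ℝ} {σ : ℝ} (hfc : ContinuousOn f (Ioi 0))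
    (hgc : ContinuousOn g (Ioi 0)) (hf0 : ∀ t ∈ Ioi (0 : ℝ), 0 ≤ f t) (hg0 : ∀ t ∈ Ioi (0 : ℝ), 0 ≤ g t)
    (hfi : IntegrableOn (fun t => t ^ (σ - 1) * f t) (Ioi 0))
    (hgi : IntegrableOn (fun t => t ^ (σ - 1) * g t) (Ioi 0))
    (h : ∀ y : ℝ, ∫ t in Ioi (0 : ℝ), (t : ℂ) ^ ((σ : ℂ) + y * I - 1) * (f t : ℂ) =
      ∫ t in Ioi (0 : ℝ), (t : ℂ) ^ ((σ : ℂ) + y * I - 1) * (g t : ℂ)) :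
    EqOn f g (Ioi 0) := by
  haveI := isFiniteMeasure_mellinMeasure hfi
  haveI := isFiniteMeasure_mellinMeasure hgi
  -- equal characteristic functions, hence equal `log`-images, hence equal measures
  have hchar : charFun ((mellinMeasure f σ).map Real.log) = charFun ((mellinMeasure g σ).map Real.log) := by
    funext y
    rw [charFun_map_log_mellinMeasure hfc hf0, charFun_map_log_mellinMeasure hgc hg0, h y]
  have hmeas : mellinMeasure f σ = mellinMeasure g σ := by
    rw [← map_exp_map_log_mellinMeasure f σ, ← map_exp_map_log_mellinMeasure g σ,
      Measure.ext_of_charFun hchar]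
  -- equal densities a.e., then everywhere by continuity
  have hpc : ∀ {h : ℝ → ℝ}, ContinuousOn h (Ioi 0) →
      ContinuousOn (fun t : ℝ => t ^ (σ - 1) * h t) (Ioi 0) := fun hc =>
    (ContinuousOn.rpow_const continuousOn_id fun t ht => Or.inl (ne_of_gt ht)).mul hc
  have hae : (fun t => ENNReal.ofReal (t ^ (σ - 1) * f t)) =ᵐ[volume.restrict (Ioi 0)]
      fun t => ENNReal.ofReal (t ^ (σ - 1) * g t) :=
    (withDensity_eq_iff_of_sigmaFinite ((hpc hfc).aemeasurable measurableSet_Ioi).ennreal_ofReal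
      ((hpc hgc).aemeasurable measurableSet_Ioi).ennreal_ofReal).1 hmeas
  have hae' : f =ᵐ[volume.restrict (Ioi 0)] g := by
    filter_upwards [hae, ae_restrict_mem measurableSet_Ioi] with t ht ht0
    have ht0 : 0 < t := ht0
    have hp : 0 < t ^ (σ - 1) := Real.rpow_pos_of_pos ht0 _
    rw [ENNReal.ofReal_eq_ofReal_iff (mul_nonneg hp.le (hf0 t ht0)) (mul_nonneg hp.le (hg0 t ht0))] at ht
    exact mul_left_cancel₀ hp.ne' ht
  exact Measure.eqOn_open_of_ae_eq hae' isOpen_Ioi hfc hgc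


/-! ### Kato's formula (Slade, Lemma 2.1.2) -/

/-- **The Stieltjes transform of Kato's density is continuous on `[0,∞)`** (`a ≠ 0`), by
dominated convergence with the integrable majorant `ρ^{(β)}(x,a)/x`. [folklore] -/
theorem continuousOn_katoStieltjes {β : ℝ} (hβ0 : 0 < β) (hβ1 : β < 1) {a : ℝ} (ha : a ≠ 0) :
    ContinuousOn (katoStieltjes β a) (Ici 0) := by
  unfold katoStieltjes
  have hbi : IntegrableOn (fun x : ℝ => x ^ ((0 : ℝ) - 1) * katoDensity β a x) (Ioi 0) :=
    integrableOn_rpow_mul_katoDensity hβ0 hβ1 ha (by linarith) hβ0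
  refine continuousOn_of_dominated (bound := fun x : ℝ => x ^ ((0 : ℝ) - 1) * katoDensity β a x)
    (fun t _ => ((measurable_katoDensity β a).div (measurable_id.add_const t)).aestronglyMeasurable)
    (fun t ht => ?_) hbi ?_
  · refine (ae_restrict_iff' measurableSet_Ioi).2 (Eventually.of_forall fun x hx => ?_)
    have hx : 0 < x := hx
    have ht : 0 ≤ t := ht
    have hρ := (katoDensity_pos hβ0 hβ1 a hx).le
    rw [Real.norm_eq_abs, abs_of_nonneg (by positivity), zero_sub, Real.rpow_neg_one,
      div_eq_inv_mul]
    exact mul_le_mul_of_nonneg_right (inv_anti₀ hx (by linarith)) hρ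
  · refine (ae_restrict_iff' measurableSet_Ioi).2 (Eventually.of_forall fun x hx => ?_)
    have hx : 0 < x := hx
    exact (continuousOn_const.div (continuousOn_const.add continuousOn_id)
      fun t ht => by have ht : 0 ≤ t := ht; exact (ne_of_gt (by linarith : 0 < x + t)))

/-- The Stieltjes transform of Kato's density is nonnegative. [folklore] -/
theorem katoStieltjes_nonneg {β : ℝ} (hβ0 : 0 < β) (hβ1 : β < 1) (a : ℝ) {t : ℝ} (ht : 0 ≤ t) :
    0 ≤ katoStieltjes β a t :=
  setIntegral_nonneg measurableSet_Ioi fun x hx =>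
    div_nonneg (katoDensity_pos hβ0 hβ1 a hx).le (by have hx : 0 < x := hx; linarith)

/-- **Mellin integrability of the Stieltjes transform of Kato's density** at `σ ∈ (0,β)`
(from the Fubini bound). [folklore] -/
theorem integrableOn_rpow_mul_katoStieltjes {β : ℝ} (hβ0 : 0 < β) (hβ1 : β < 1) {a : ℝ}
    (ha : a ≠ 0) {σ : ℝ} (hσ0 : 0 < σ) (hσβ : σ < β) :
    IntegrableOn (fun t : ℝ => t ^ (σ - 1) * katoStieltjes β a t) (Ioi 0) := by
  have h := (integrable_prod_katoDensity hβ0 hβ1 ha hσ0 hσβ).integral_prod_left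
  refine h.congr (Eventually.of_forall fun t => ?_)
  simp only [katoStieltjes]
  rw [← integral_const_mul]

/-- `t ↦ 1/(t^β + a)` is continuous on `[0,∞)` (`β > 0`, `a > 0`). [folklore] -/
theorem continuousOn_inv_rpow_add {β : ℝ} (hβ0 : 0 < β) {a : ℝ} (ha : 0 < a) :
    ContinuousOn (fun t : ℝ => 1 / (t ^ β + a)) (Ici 0) := by
  refine continuousOn_const.div ?_ fun t ht => ?_
  · exact fun t _ => ((Real.continuousAt_rpow_const t β (Or.inr hβ0.le)).add
      continuousAt_const).continuousWithinAt
  · have ht : 0 ≤ t := ht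
    have : 0 ≤ t ^ β := Real.rpow_nonneg ht _
    linarith

/-- Mellin integrability of `1/(t^β + a)` at `σ ∈ (0,β)` (`a > 0`). [folklore] -/
theorem integrableOn_rpow_mul_inv_rpow_add {β : ℝ} {a : ℝ} (ha : 0 < a) {σ : ℝ}
    (hσ0 : 0 < σ) (hσβ : σ < β) :
    IntegrableOn (fun t : ℝ => t ^ (σ - 1) * (1 / (t ^ β + a))) (Ioi 0) := by
  have hmeas : ∀ S : Set ℝ, MeasurableSet S →
      AEStronglyMeasurable (fun t : ℝ => t ^ (σ - 1) * (1 / (t ^ β + a))) (volume.restrict S) :=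
    fun S _ => ((measurable_id.pow_const _).mul
      (measurable_const.div ((measurable_id.pow_const _).add_const _))).aestronglyMeasurable
  have hpt : ∀ t : ℝ, 0 < t → 0 ≤ t ^ (σ - 1) * (1 / (t ^ β + a)) := fun t ht => by
    have : 0 ≤ t ^ β := Real.rpow_nonneg ht.le _
    positivity
  have h1 : IntegrableOn (fun t : ℝ => t ^ (σ - 1) * (1 / (t ^ β + a))) (Ioc 0 1) := by
    have hint : IntegrableOn (fun t : ℝ => a⁻¹ * t ^ (σ - 1)) (Ioc 0 1) :=
      ((intervalIntegral.intervalIntegrable_rpow' (by linarith) (a := 0) (b := 1)).1).const_mul _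
    refine hint.mono' (hmeas _ measurableSet_Ioc) ?_
    refine (ae_restrict_iff' measurableSet_Ioc).2 (Eventually.of_forall fun t ht => ?_)
    have ht0 : 0 < t := ht.1
    have htb : 0 ≤ t ^ β := Real.rpow_nonneg ht0.le _
    rw [Real.norm_eq_abs, abs_of_nonneg (hpt t ht0), mul_comm a⁻¹]
    gcongr
    rw [one_div]
    exact inv_anti₀ ha (by linarith)
  have h2 : IntegrableOn (fun t : ℝ => t ^ (σ - 1) * (1 / (t ^ β + a))) (Ioi 1) := by
    have hint : IntegrableOn (fun t : ℝ => t ^ (σ - 1 + -β)) (Ioi 1) :=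
      integrableOn_Ioi_rpow_of_lt (by linarith) one_pos
    refine hint.mono' (hmeas _ measurableSet_Ioi) ?_
    refine (ae_restrict_iff' measurableSet_Ioi).2 (Eventually.of_forall fun t ht => ?_)
    have ht1 : 1 < t := ht
    have ht0 : 0 < t := by linarith
    have htb : 0 < t ^ β := Real.rpow_pos_of_pos ht0 _
    rw [Real.norm_eq_abs, abs_of_nonneg (hpt t ht0), Real.rpow_add ht0, Real.rpow_neg ht0.le]
    gcongr
    rw [one_div]
    exact inv_anti₀ htb (by linarith)
  have h := h1.union h2
  rwa [Ioc_union_Ioi_eq_Ioi zero_le_one] at h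

/-- **Kato's formula for `t, a > 0`** (the main case of Slade's Lemma 2.1.2):
`1/(t^β + a) = ∫₀^∞ ρ^{(β)}(s,a)/(s+t) ds`, `β ∈ (0,1)` — both sides are nonnegative continuous
functions of `t ∈ (0,∞)` with the same Mellin transform `π a^{s/β-1}/(β sin(πs/β))` on the line
`Re s = β/2`. [cite: Slade2017, Lemma 2.1.2] -/
theorem kato_formula_pos {β : ℝ} (hβ0 : 0 < β) (hβ1 : β < 1) {t a : ℝ} (ht : 0 < t) (ha : 0 < a) :
    1 / (t ^ β + a) = katoStieltjes β a t := by
  have hσ0 : 0 < β / 2 := by positivity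
  have hσβ : β / 2 < β := by linarith
  refine eqOn_of_mellin_eq (σ := β / 2) ((continuousOn_inv_rpow_add hβ0 ha).mono Ioi_subset_Ici_self)
    ((continuousOn_katoStieltjes hβ0 hβ1 ha.ne').mono Ioi_subset_Ici_self)
    (fun t ht => ?_) (fun t ht => katoStieltjes_nonneg hβ0 hβ1 a (le_of_lt ht))
    (integrableOn_rpow_mul_inv_rpow_add ha hσ0 hσβ)
    (integrableOn_rpow_mul_katoStieltjes hβ0 hβ1 ha.ne' hσ0 hσβ) (fun y => ?_) ht
  · have ht : 0 < t := ht
    have : 0 ≤ t ^ β := Real.rpow_nonneg ht.le _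
    positivity
  · set s : ℂ := (β / 2 : ℝ) + y * I with hs
    have hsre : s.re = β / 2 := by simp [hs]
    have hs0 : 0 < s.re := by rw [hsre]; exact hσ0
    have hsβ' : s.re < β := by rw [hsre]; exact hσβ
    have h1 := mellin_inv_rpow_add hβ0 ha hs0 hsβ'
    have h2 := mellin_katoStieltjes hβ0 hβ1 ha hs0 hsβ'
    have h1' : ∫ t in Ioi (0 : ℝ), (t : ℂ) ^ (s - 1) * (((1 / (t ^ β + a) : ℝ)) : ℂ) =
        ∫ t in Ioi (0 : ℝ), (t : ℂ) ^ (s - 1) / ((t ^ β : ℝ) + a) := by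
      refine setIntegral_congr_fun measurableSet_Ioi fun t ht => ?_
      push_cast
      ring
    rw [h1', h1, h2]

/-- **Kato's formula, all cases of Slade's Lemma 2.1.2.** "Let `β ∈ (0,1)`, `t ≥ 0` and `a ≥ 0`, excepting
`t = a = 0`. Then `1/(t^β + a) = ∫₀^∞ ρ^{(β)}(s,a)/(s+t) ds`", with
`ρ^{(β)}(s,a) = (sin πβ/π) s^β/(s^{2β} + a² + 2as^β cos πβ)` ([Kato60], [Yosi80], rediscovered in
[Mitt16]; the printed proof is a keyhole contour integral — here: Mellin transforms of both sides
agree on a vertical line (Euler's Beta integral, analytic continuation of the Stieltjes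
transform of a power, partial fractions, Fubini) and Mellin transforms of nonnegative continuous
functions are unique (characteristic functions); `t = 0` by continuity, `a = 0` directly).
[cite: Slade2017, Lemma 2.1.2] -/
theorem kato_formula {β : ℝ} (hβ0 : 0 < β) (hβ1 : β < 1) {t a : ℝ} (ht : 0 ≤ t) (ha : 0 ≤ a)
    (hta : 0 < t ∨ 0 < a) :
    1 / (t ^ β + a) = ∫ s in Ioi (0 : ℝ), katoDensity β a s / (s + t) := by
  change 1 / (t ^ β + a) = katoStieltjes β a t
  rcases ha.lt_or_eq with ha' | ha'
  · -- `a > 0`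
    rcases ht.lt_or_eq with ht' | ht'
    · exact kato_formula_pos hβ0 hβ1 ht' ha'
    · -- `t = 0`: both sides are right-continuous at `0` and agree on `(0,∞)`
      subst ht'
      have hf : ContinuousWithinAt (fun t : ℝ => 1 / (t ^ β + a)) (Ici 0) 0 :=
        continuousOn_inv_rpow_add hβ0 ha' 0 Set.self_mem_Ici
      have hg : ContinuousWithinAt (katoStieltjes β a) (Ici 0) 0 :=
        continuousOn_katoStieltjes hβ0 hβ1 ha'.ne' 0 Set.self_mem_Ici
      have hf' : Tendsto (fun t : ℝ => 1 / (t ^ β + a)) (𝓝[>] 0) (𝓝 (1 / ((0 : ℝ) ^ β + a))) :=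
        hf.tendsto.mono_left (nhdsWithin_mono _ Ioi_subset_Ici_self)
      have hg' : Tendsto (katoStieltjes β a) (𝓝[>] 0) (𝓝 (katoStieltjes β a 0)) :=
        hg.tendsto.mono_left (nhdsWithin_mono _ Ioi_subset_Ici_self)
      have heq : (fun t : ℝ => 1 / (t ^ β + a)) =ᶠ[𝓝[>] 0] katoStieltjes β a :=
        eventually_nhdsWithin_of_forall fun t ht => kato_formula_pos hβ0 hβ1 ht ha'
      exact tendsto_nhds_unique (hf'.congr' heq) hg'
  · -- `a = 0`: `ρ^{(β)}(s,0) = (sin πβ/π) s^{-β}`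
    subst ha'
    have ht' : 0 < t := hta.resolve_right (lt_irrefl _)
    have hsin : 0 < Real.sin (π * β) := Real.sin_pos_of_pos_of_lt_pi (by positivity)
      (by nlinarith [Real.pi_pos])
    have hρ : ∀ s ∈ Ioi (0 : ℝ), katoDensity β 0 s / (s + t) =
        Real.sin (π * β) / π * (s ^ ((1 - β) - 1) / (s + t)) := by
      intro s hs
      have hs : 0 < s := hs
      unfold katoDensity
      have h2 : s ^ (2 * β) = s ^ β * s ^ β := by rw [two_mul, Real.rpow_add hs]
      have hsb : 0 < s ^ β := Real.rpow_pos_of_pos hs _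
      rw [h2, show (1 - β) - 1 = -β by ring, Real.rpow_neg hs.le]
      field_simp
      ring
    rw [katoStieltjes, setIntegral_congr_fun measurableSet_Ioi hρ, integral_const_mul,
      integral_rpow_div_add (by linarith) (by linarith) ht', show (1 - β) - 1 = -β by ring,
      Real.rpow_neg ht, show π * (1 - β) = π - π * β by ring, Real.sin_pi_sub, add_zero]
    field_simp

end Kato

/-- **Slade, Lemma 2.1.2 (Kato's formula for the resolvent of a fractional power).** "Let
`β ∈ (0,1)`, `t ≥ 0` and `a ≥ 0`, excepting `t = a = 0`. Then
`1/(t^β + a) = ∫₀^∞ (1/(s+t)) ρ^{(β)}(s,a) ds`" with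
`ρ^{(β)}(s,a) = (sin πβ/π) · s^β/(s^{2β} + a² + 2as^β cos πβ)` (`Kato.katoDensity β a s`),
the integral being the Lebesgue integral over `(0,∞)`. [cite: Slade2017, Lemma 2.1.2] -/
theorem Slade2017_lem212 {β : ℝ} (hβ0 : 0 < β) (hβ1 : β < 1) {t a : ℝ} (ht : 0 ≤ t) (ha : 0 ≤ a)
    (hta : 0 < t ∨ 0 < a) :
    1 / (t ^ β + a) = ∫ s in Ioi (0 : ℝ), Kato.katoDensity β a s / (s + t) :=
  Kato.kato_formula hβ0 hβ1 ht ha hta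

end LongRangePhi4

end Literature.Barriers.CriticalPhenomena
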